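/-
Copyright: b2b-lace packet (carver, gen 53).  [FvdH17] §4.2 (4.17) for the repulsive SQUARE with two EXACT lines,
`𝓢_{1̲,m₂,1̲,m₄}(v,y,w,x)`: the two exact bonds pin TWO edge positions of the coded trail (`r₁ = 1`, `r₃ = r₂ + 1`), so
the (5.40)-type extraction of [NoBLE17] §5.3.2 applies with line indices `(1 + m₂, 1 + m₄)`, junction `y`, LINEAR
multiplicity and the two remainder slots of the repulsive bubble — node EXL-XSLOT, leaf XSLOT-S (square) of the cell's
N76 map.  Proofs only; no named fact; no numeral; no dimension.
-/
import Literature.Probability.FitznerVanDerHofstad2017.RepulsiveSquareExtractionIndep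
import Literature.Probability.FitznerVanDerHofstad2017.NobleExactLegSlots
import Literature.Probability.FitznerVanDerHofstad2017.NobleRemainderBound
import HarnessLib

/-!
# [FvdH17] (4.17) with two exact bonds (square): the trail-level extraction at linear multiplicity

For the instance `Letters.perc d p` of the NoBLE letters, the repulsive square letter whose first and third lines are
exact bonds, `𝓢_{1̲,m₂,1̲,m₄}(v,y,w,x) = max_c ℙ_p^{⊗4}({0 –1̲– v}_{c₀} ⊛ {v ←m₂→ y}_{c₁} ⊛ {y –1̲– w}_{c₂} ⊛ {w ←m₄→ x}_{c₃})`,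
is bounded by the right-hand side of [NoBLE17] (5.40) at line indices `(1 + m₂, 1 + m₄)` with the junction read at
`y`, the positions of `v` (`= W(1)`) and `w` (`= W(r+1)`) being determined by the index:

* **Coding** (`exists_trail_of_mem_genDisjOcc_lineEvents₄_eqOne₁₃`): restricting the four levels to the witness sets,
  the two exact witnesses shrunk to their bonds, the landed square coding `exists_trail_of_mem_genDisjConnN_sqLines`
  yields ONE bond-self-avoiding word `W` with `W(1) = v`, `W(r) = y`, `W(r+1) = w`, `W(L) = x` and the arcs `[0,1)`,
  `[1,r)`, `[r,r+1)`, `[r+1,L)` open on the levels `c₀,…,c₃` (`#arc = length` for a trail pins `r₁ = 1`, `r₃ = r₂+1`).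
* **Extraction** (`mem_sqBoxes_of_trail_eqOne₁₃`): cut at `M` as in (5.40) with `(m₁, m₂) := (1 + m₂, 1 + m₄)`; the boxes
  are the landed `sqPiecesE W 1 r (r+1)`, `sqPiecesO u 1 r (r+1) x`, `sqPiecesT3 u₁ 1 [e] u₄ x y w` (middle word of
  length `1`; the first bond stays inside `u₁`, whence the hypothesis `m₄ + 2 ≤ M`), so `mem_sqBox*_of_trail` and
  `piReal_sqBox*_le` (independence across levels × BK within) are used verbatim.
* **Summation** (`piReal_genDisjOcc_lineEvents₄_eqOne₁₃_le`, `sum_sum_perc_S_eqOne_ge_eqOne_ge_toReal_le_extraction`,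
  `sum3_perc_S_eqOne_ge_eqOne_ge_toReal_le_slots`, `tsum_tsum_sum_perc_S_eqOne_ge_eqOne_ge_stepVec_le_ofReal`; cells
  `perc_matAiota_one_one_le_xslot`, `perc_tsum_tsum_sum_kdc_S_one_one_le_xslot`): the sum over `(v,w)` is fiberwise
  over the determined pair, then the landed `sum_le_extraction_of_pointwise` and `sum_le_repBubble_slots` give the
  (5.40) right-hand side `bubbleSlotR p Γ̄₂ (1+m₂) (1+m₄) M N R₁ R₂`.

## References
* [FvdH17] R. Fitzner, R. van der Hofstad, Mean-field behavior for nearest-neighbor percolation in `d > 10`,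
  Electron. J. Probab. 22 (2017) no. 43; arXiv:1506.07977v2 — §4.2 Def. 4.1, (4.16)–(4.18) and the display after (4.18)
  (v2 pp. 34–36 = EJP p. 33); App. B Table B.4 rows (0,1), (1,1) (p. 74).
* [NoBLE17] R. Fitzner, R. van der Hofstad, Generalized approach to the non-backtracking lace expansion,
  Probab. Theory Relat. Fields 169 (2017) 1041–1119 — §5.3.1 (5.35)–(5.38) p. 1097, §5.3.2 (5.40)–(5.42) p. 1098.
-/

noncomputable section

namespace Literature.Probability.FitznerVanDerHofstad2017.NobleBlocks

open _root_.MeasureTheory Finset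
open scoped BigOperators ENNReal
open Literature.Probability.LatticeModels Literature.Probability.Percolation
open Literature.Barriers.CriticalPhenomena
open Literature.Probability.FitznerVanDerHofstad2017
open Literature.Probability.FitznerVanDerHofstad2017.NobleBlocks.LenIdx

variable {d : ℕ}

/-! ## A. Coding: the two exact bonds are two edges of the trail -/

/-- **Coding of a member of `𝓢_{1̲,m₂,1̲,m₄}(v,y,w,x)`.**  If
`ω ∈ {0 –1̲– v}_{c₀} ⊛ {v ←m₂→ y}_{c₁} ⊛ {y –1̲– w}_{c₂} ⊛ {w ←m₄→ x}_{c₃}` (lattice configurations), there is ONE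
bond-self-avoiding word `W` of length `L` with `W(1) = v`, `W(r) = y`, `W(r+1) = w`, `W(L) = x` (`1 + m₂ ≤ r`,
`r + 1 + m₄ ≤ L`), the bond `[0,1)` in `ω_{c₀}`, the arc `[1,r)` open in `ω_{c₁}`, the bond `[r,r+1)` in `ω_{c₂}`, the
arc `[r+1,L)` in `ω_{c₃}`: the landed square coding applied to the witness sets, the exact witnesses shrunk to bonds.
[cite: FitznerVanDerHofstad2017, §4.2 Def. 4.1, (4.17) and the sentence after it (arXiv:1506.07977v2 pp. 35–36 = EJP p. 33)]
[cite: FitznerVanDerHofstad2016NoBLE, §5.3.1 (5.35) PTRF p. 1097] -/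
theorem exists_trail_of_mem_genDisjOcc_lineEvents₄_eqOne₁₃ {k : ℕ} {c : Fin 4 → Fin k}
    {ω : Fin k → BondConfig (Site d)} (hω : ∀ j, ω j ⊆ (zdGraph d).edgeSet) {m₂ m₄ : ℕ} {v y w x : Site d}
    (h : ω ∈ genDisjOcc (lineEvents₄ (eq 1) (ge m₂) (eq 1) (ge m₄) v y w x) c) :
    ∃ (L r : ℕ) (W : Fin L → Fin d × Bool), IsTrail W ∧ 1 + m₂ ≤ r ∧ r + 1 + m₄ ≤ L ∧
      wordPos W 1 = v ∧ wordPos W r = y ∧ wordPos W (r + 1) = w ∧ wordPos W L = x ∧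
      (↑(wordArc W 0 1) : Set (Sym2 (Site d))) ⊆ ω (c 0) ∧
        (↑(wordArc W 1 r) : Set (Sym2 (Site d))) ⊆ ω (c 1) ∧
          (↑(wordArc W r (r + 1)) : Set (Sym2 (Site d))) ⊆ ω (c 2) ∧
            (↑(wordArc W (r + 1) L) : Set (Sym2 (Site d))) ⊆ ω (c 3) := by
  classical
  obtain ⟨K, hKω, hKA, hdisj⟩ := h
  have hA0 : K 0 ∈ (openConnEq 1 (0 : Site d) v : Set (BondConfig (Site d))) := by
    simpa [lineEvents₄] using hKA 0
  have hA1 : K 1 ∈ (openConnGe m₂ v y : Set (BondConfig (Site d))) := by simpa [lineEvents₄] using hKA 1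
  have hA2 : K 2 ∈ (openConnEq 1 y w : Set (BondConfig (Site d))) := by simpa [lineEvents₄] using hKA 2
  have hA3 : K 3 ∈ (openConnGe m₄ w x : Set (BondConfig (Site d))) := by simpa [lineEvents₄] using hKA 3
  obtain ⟨h0v, hb₁⟩ := (mem_openConnEq_one_iff (0 : Site d) v (K 0)).1 hA0
  obtain ⟨hyw, hb₃⟩ := (mem_openConnEq_one_iff y w (K 2)).1 hA2
  have hb₁1 : s((0 : Site d), v) ∉ K 1 := fun h' =>
    Set.disjoint_left.1 (hdisj (show (0 : Fin 4) ≠ 1 by decide)) hb₁ h'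
  have hb₁3 : s((0 : Site d), v) ∉ K 3 := fun h' =>
    Set.disjoint_left.1 (hdisj (show (0 : Fin 4) ≠ 3 by decide)) hb₁ h'
  have hb₃1 : s(y, w) ∉ K 1 := fun h' => Set.disjoint_left.1 (hdisj (show (2 : Fin 4) ≠ 1 by decide)) hb₃ h'
  have hb₃3 : s(y, w) ∉ K 3 := fun h' => Set.disjoint_left.1 (hdisj (show (2 : Fin 4) ≠ 3 by decide)) hb₃ h'
  have hb₁₃ : s((0 : Site d), v) ≠ s(y, w) := fun h' =>
    Set.disjoint_left.1 (hdisj (show (0 : Fin 4) ≠ 2 by decide)) hb₁ (h' ▸ hb₃)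
  have hd13 : Disjoint (K 1) (K 3) := hdisj (show (1 : Fin 4) ≠ 3 by decide)
  -- the witness configurations on four levels, the exact ones shrunk to their bonds
  let ω' : Fin 4 → BondConfig (Site d) := ![{s((0 : Site d), v)}, K 1, {s(y, w)}, K 3]
  have hω'0 : ω' 0 = {s((0 : Site d), v)} := rfl
  have hω'1 : ω' 1 = K 1 := rfl
  have hω'2 : ω' 2 = {s(y, w)} := rfl
  have hω'3 : ω' 3 = K 3 := rfl
  have hω'lat : ∀ j, ω' j ⊆ (zdGraph d).edgeSet := by
    intro j
    fin_cases j
    · show ({s((0 : Site d), v)} : Set (Sym2 (Site d))) ⊆ _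
      exact Set.singleton_subset_iff.2 (hω _ (hKω 0 hb₁))
    · exact (hKω 1).trans (hω _)
    · show ({s(y, w)} : Set (Sym2 (Site d))) ⊆ _
      exact Set.singleton_subset_iff.2 (hω _ (hKω 2 hb₃))
    · exact (hKω 3).trans (hω _)
  have hmem : ω' ∈ genDisjConnN (sqLines (fun i : Fin 4 => i) 1 m₂ 1 m₄ v y w x) := by
    refine ⟨fun i => ω' i, fun i => ?_, fun i => ?_, ?_⟩
    · fin_cases i <;> simp [sqLines]
    · fin_cases i
      · simpa [sqLines, GDLine.event, hω'0] using
          openConnEq_subset_openConnGe 1 (0 : Site d) v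
            ((mem_openConnEq_one_iff (0 : Site d) v ({s((0 : Site d), v)} : Set (Sym2 (Site d)))).2
              ⟨h0v, Set.mem_singleton _⟩)
      · simpa [sqLines, GDLine.event, hω'1] using hA1
      · simpa [sqLines, GDLine.event, hω'2] using
          openConnEq_subset_openConnGe 1 y w
            ((mem_openConnEq_one_iff y w ({s(y, w)} : Set (Sym2 (Site d)))).2 ⟨hyw, Set.mem_singleton _⟩)
      · simpa [sqLines, GDLine.event, hω'3] using hA3
    · intro i j hij
      fin_cases i <;> fin_cases j
      · exact absurd rfl hij
      · simpa [hω'0, hω'1] using hb₁1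
      · simpa [hω'0, hω'2] using hb₁₃
      · simpa [hω'0, hω'3] using hb₁3
      · simpa [hω'0, hω'1] using hb₁1
      · exact absurd rfl hij
      · simpa [hω'1, hω'2] using hb₃1
      · simpa [hω'1, hω'3] using hd13
      · simpa [hω'0, hω'2] using hb₁₃.symm
      · simpa [hω'1, hω'2] using hb₃1
      · exact absurd rfl hij
      · simpa [hω'2, hω'3] using hb₃3
      · simpa [hω'0, hω'3] using hb₁3
      · simpa [hω'1, hω'3] using hd13.symm
      · simpa [hω'2, hω'3] using hb₃3
      · exact absurd rfl hij
  obtain ⟨L, r₁, r₂, r₃, W, hW, hr₁, hr₁₂, hr₂₃, hr₃L, hv, hy, hw, hx, h0, h1, h2, h3⟩ :=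
    exists_trail_of_mem_genDisjConnN_sqLines hω'lat hmem
  -- the first arc is the single bond `(0,v)`: `r₁ = 1`
  have hcard₁ : (wordArc W 0 r₁).card ≤ 1 := by
    have hsub : wordArc W 0 r₁ ⊆ {s((0 : Site d), v)} := by
      intro e he
      have := h0 (Finset.mem_coe.2 he)
      simpa [hω'0] using this
    simpa using Finset.card_le_card hsub
  rw [hW.card_wordArc (by omega)] at hcard₁
  -- the third arc is the single bond `(y,w)`: `r₃ = r₂ + 1`
  have hcard₃ : (wordArc W r₂ r₃).card ≤ 1 := by
    have hsub : wordArc W r₂ r₃ ⊆ {s(y, w)} := by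
      intro e he
      have := h2 (Finset.mem_coe.2 he)
      simpa [hω'2] using this
    simpa using Finset.card_le_card hsub
  rw [hW.card_wordArc (by omega)] at hcard₃
  have hr₁' : r₁ = 1 := by omega
  have hr₃' : r₃ = r₂ + 1 := by omega
  subst hr₁' hr₃'
  refine ⟨L, r₂, W, hW, hr₁₂, by omega, hv, hy, hw, hx, ?_, ?_, ?_, ?_⟩
  · refine h0.trans ?_
    rw [hω'0]
    exact Set.singleton_subset_iff.2 (hKω 0 hb₁)
  · exact h1.trans (by rw [hω'1]; exact hKω 1)
  · refine h2.trans ?_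
    rw [hω'2]
    exact Set.singleton_subset_iff.2 (hKω 2 hb₃)
  · exact h3.trans (by rw [hω'3]; exact hKω 3)

/-! ## B. Extraction: an open labelled trail with its two pinned bonds lies in one of the (5.40) boxes -/

section Extraction

variable {k : ℕ} (c : Fin 4 → Fin k)

/-- **Extraction with two pinned bonds** (the three cases of (5.40) at `(m₁, m₂) := (1 + m₂, 1 + m₄)`, junction `y`,
the positions of `v` and `w` determined): an open labelled trail lies in the labelled box of an EXPLICIT index
(`L < M`), of a ONE-TAIL index (`r < M − (1+m₄)`), or of a TWO-TAIL index (`r ≥ M − (1+m₄)`; the first bond stays in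
`u₁` because `m₄ + 2 ≤ M`) — the landed `sqPiecesE W 1 r (r+1)`, `sqPiecesO u 1 r (r+1) x`,
`sqPiecesT3 u₁ 1 [e] u₄ x y w`.
[cite: FitznerVanDerHofstad2016NoBLE, §5.3.1 (5.38) p. 1097, §5.3.2 (5.40)–(5.42) p. 1098]
[cite: FitznerVanDerHofstad2017, §4.2, display after (4.18) (arXiv:1506.07977v2 p. 36 = EJP p. 33)] -/
theorem mem_sqBoxes_of_trail_eqOne₁₃ (m₂ m₄ M : ℕ) (hM : m₄ + 2 ≤ M) {ω : Fin k → BondConfig (Site d)} {L r : ℕ}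
    {v y w x : Site d} {W : Fin L → Fin d × Bool} (hW : IsTrail W) (hr : 1 + m₂ ≤ r) (hrL : r + 1 + m₄ ≤ L)
    (hv : wordPos W 1 = v) (hy : wordPos W r = y) (hw : wordPos W (r + 1) = w) (hx : wordPos W L = x)
    (h0 : (↑(wordArc W 0 1) : Set (Sym2 (Site d))) ⊆ ω (c 0))
    (h1 : (↑(wordArc W 1 r) : Set (Sym2 (Site d))) ⊆ ω (c 1))
    (h2 : (↑(wordArc W r (r + 1)) : Set (Sym2 (Site d))) ⊆ ω (c 2))
    (h3 : (↑(wordArc W (r + 1) L) : Set (Sym2 (Site d))) ⊆ ω (c 3)) :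
    (∃ LW ∈ idxExplicitB (1 + m₂) (1 + m₄) M x y,
        (wordPos LW.2.1 1, wordPos LW.2.1 (LW.2.2 + 1)) = (v, w) ∧
          ω ∈ boxOf₄ (sqPiecesE LW.2.1 1 LW.2.2 (LW.2.2 + 1)) sqLabE c) ∨
      (∃ ur ∈ idxOneTailB (d := d) (1 + m₂) (1 + m₄) M y,
          (wordPos ur.1 1, wordPos ur.1 (ur.2 + 1)) = (v, w) ∧
            ω ∈ boxOf₄ (sqPiecesO ur.1 1 ur.2 (ur.2 + 1) x) sqLabO c) ∨
        ∃ uu ∈ idxTwoTail (d := d) (1 + m₄) M,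
          (wordPos uu.1 1, y + wordPos uu.2 1) = (v, w) ∧
            ω ∈ boxOf₄ (sqPiecesT3 (M := M) (m₃ := 1) (m₄ := m₄) uu.1 1 (wordTake uu.2 1 (by omega))
              (wordSeg uu.2 1 m₄ (by omega)) x y (y + wordPos uu.2 1)) sqLabT3 c := by
  classical
  by_cases hLM : L < M
  · refine Or.inl ⟨⟨L, (W, r)⟩, ?_, ?_, ?_⟩
    · simp only [idxExplicitB, Finset.mem_sigma, Finset.mem_filter, Finset.mem_product, mem_trailWordsTo,
        Finset.mem_Ico, Finset.mem_Icc]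
      exact ⟨⟨by omega, hLM⟩, ⟨⟨hW, hx⟩, hr, by omega⟩, hy⟩
    · show (wordPos W 1, wordPos W (r + 1)) = (v, w)
      rw [hv, hw]
    · show ω ∈ boxOf₄ (sqPiecesE W 1 r (r + 1)) sqLabE c
      exact mem_sqBoxE_of_trail c hW (by omega) (Nat.le_succ r) (by omega) h0 h1 h2 h3
  · replace hLM : M ≤ L := not_lt.1 hLM
    by_cases hrM : r < M - (1 + m₄)
    · refine Or.inr (Or.inl ⟨(wordTake W M hLM, r), ?_, ?_, ?_⟩)
      · rw [idxOneTailB, Finset.mem_filter, Finset.mem_product, mem_trailWords, Finset.mem_Ico]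
        exact ⟨⟨hW.wordTake hLM, hr, hrM⟩, by rw [wordPos_wordTake W hLM (by omega), hy]⟩
      · show (wordPos (wordTake W M hLM) 1, wordPos (wordTake W M hLM) (r + 1)) = (v, w)
        rw [wordPos_wordTake W hLM (by omega), wordPos_wordTake W hLM (by omega), hv, hw]
      · show ω ∈ boxOf₄ (sqPiecesO (wordTake W M hLM) 1 r (r + 1) x) sqLabO c
        exact mem_sqBoxO_of_trail c hW hLM (by omega) (Nat.le_succ r) (by omega) hx h0 h1 h2 h3
    · replace hrM : M - (1 + m₄) ≤ r := not_lt.1 hrM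
      have hML : M - (1 + m₄) ≤ L := by omega
      have hrL' : r + (1 + m₄) ≤ L := by omega
      have hr1L : r + 1 ≤ L := by omega
      have hwy : y + wordPos (wordSeg W r (1 + m₄) hrL') 1 = w := by
        rw [← hy, wordPos_wordSeg W hrL' (by omega), hw]
      refine Or.inr (Or.inr ⟨(wordTake W (M - (1 + m₄)) hML, wordSeg W r (1 + m₄) hrL'), ?_, ?_, ?_⟩)
      · rw [idxTwoTail, Finset.mem_product, mem_trailWords, mem_trailWords]
        exact ⟨hW.wordTake hML, hW.wordSeg hrL'⟩
      · show (wordPos (wordTake W (M - (1 + m₄)) hML) 1, y + wordPos (wordSeg W r (1 + m₄) hrL') 1) = (v, w)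
        rw [wordPos_wordTake W hML (by omega), hv, hwy]
      · show ω ∈ boxOf₄ (sqPiecesT3 (M := M) (m₃ := 1) (m₄ := m₄) (wordTake W (M - (1 + m₄)) hML) 1
          (wordTake (wordSeg W r (1 + m₄) hrL') 1 (by omega)) (wordSeg (wordSeg W r (1 + m₄) hrL') 1 m₄ (by omega))
          x y (y + wordPos (wordSeg W r (1 + m₄) hrL') 1)) sqLabT3 c
        rw [wordTake_wordSeg_one W hrL' hr1L, wordSeg_wordSeg_one W hrL' hrL, hwy]
        exact mem_sqBoxT3_of_trail c hW (by omega) hrM le_rfl hrL hML hr1L hy hw hx h0 h1 h2 h3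

end Extraction

/-! ## C. The pointwise bound of a member -/

section Pointwise

variable {k : ℕ}

/-- **(4.17) for the square with two exact bonds, member `c`, pointwise in `(v,w)` at junction `y`, by extraction**:
`ℙ_p^{⊗k}({0 –1̲– v}_{c₀} ⊛ {v ←m₂→ y}_{c₁} ⊛ {y –1̲– w}_{c₂} ⊛ {w ←m₄→ x}_{c₃})` is at most the sum of the (5.40)
values (junction `y`, line indices `(1+m₂, 1+m₄)`) over the indices whose determined pair is `(v,w)`:
configurations off the lattice are null; on the lattice the coded trail lies in a box (`mem_sqBoxes_of_trail_eqOne₁₃`)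
whose measure is the value (`piReal_sqBoxE_le`, `piReal_sqBoxO_le`, `piReal_sqBoxT3_le`, middle tail `τ_p(w,w) = 1`).
[cite: FitznerVanDerHofstad2016NoBLE, §5.3.2 (5.40)–(5.42) PTRF p. 1098]
[cite: FitznerVanDerHofstad2017, §4.2 (4.17) and the display after (4.18) (arXiv:1506.07977v2 p. 36 = EJP p. 33)] -/
theorem piReal_genDisjOcc_lineEvents₄_eqOne₁₃_le (c : Fin 4 → Fin k) (p : unitInterval) (m₂ m₄ M : ℕ)
    (hM : m₄ + 2 ≤ M) (x y : Site d) (vw : Site d × Site d) :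
    (Measure.pi (fun _ : Fin k => bondPercolation (zdGraph d) p)).real
        (genDisjOcc (lineEvents₄ (eq 1) (ge m₂) (eq 1) (ge m₄) vw.1 y vw.2 x) c) ≤
      (∑ LW ∈ (idxExplicitB (1 + m₂) (1 + m₄) M x y).filter
          (fun LW => (wordPos LW.2.1 1, wordPos LW.2.1 (LW.2.2 + 1)) = vw), (p : ℝ) ^ LW.1) +
        (∑ ur ∈ (idxOneTailB (d := d) (1 + m₂) (1 + m₄) M y).filter
            (fun ur => (wordPos ur.1 1, wordPos ur.1 (ur.2 + 1)) = vw), (p : ℝ) ^ M * tau d p (wordPos ur.1 M) x) +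
          ∑ uu ∈ (idxTwoTail (d := d) (1 + m₄) M).filter (fun uu => (wordPos uu.1 1, y + wordPos uu.2 1) = vw),
            (p : ℝ) ^ (M - (1 + m₄)) * (p : ℝ) ^ (1 + m₄) *
              (tau d p (wordPos uu.1 (M - (1 + m₄))) y * tau d p (y + wordPos uu.2 (1 + m₄)) x) := by
  classical
  obtain ⟨v, w⟩ := vw
  set μ := bondPercolation (zdGraph d) p with hμ
  set ν : Measure (Fin k → BondConfig (Site d)) := Measure.pi (fun _ : Fin k => μ) with hν
  set T : Set (Fin k → BondConfig (Site d)) :=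
    genDisjOcc (lineEvents₄ (eq 1) (ge m₂) (eq 1) (ge m₄) v y w x) c with hT
  set IE := (idxExplicitB (1 + m₂) (1 + m₄) M x y).filter
    (fun LW => (wordPos LW.2.1 1, wordPos LW.2.1 (LW.2.2 + 1)) = (v, w)) with hIE
  set IO := (idxOneTailB (d := d) (1 + m₂) (1 + m₄) M y).filter
    (fun ur => (wordPos ur.1 1, wordPos ur.1 (ur.2 + 1)) = (v, w)) with hIO
  set IT := (idxTwoTail (d := d) (1 + m₄) M).filter (fun uu => (wordPos uu.1 1, y + wordPos uu.2 1) = (v, w))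
    with hIT
  set UE : Set (Fin k → BondConfig (Site d)) :=
    ⋃ LW ∈ IE, boxOf₄ (sqPiecesE LW.2.1 1 LW.2.2 (LW.2.2 + 1)) sqLabE c with hUE
  set UO : Set (Fin k → BondConfig (Site d)) :=
    ⋃ ur ∈ IO, boxOf₄ (sqPiecesO ur.1 1 ur.2 (ur.2 + 1) x) sqLabO c with hUO
  set UT : Set (Fin k → BondConfig (Site d)) :=
    ⋃ uu ∈ IT, boxOf₄ (sqPiecesT3 (M := M) (m₃ := 1) (m₄ := m₄) uu.1 1 (wordTake uu.2 1 (by omega))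
      (wordSeg uu.2 1 m₄ (by omega)) x y (y + wordPos uu.2 1)) sqLabT3 c with hUT
  set bad : Set (Fin k → BondConfig (Site d)) :=
    ⋃ j : Fin k, Function.eval j ⁻¹' {ω | ¬ ω ⊆ (zdGraph d).edgeSet} with hbad
  have h0 : μ {ω | ¬ ω ⊆ (zdGraph d).edgeSet} = 0 := by
    have := ProbabilityTheory.setBernoulli_ae_subset (u := (zdGraph d).edgeSet) (p := p)
    rw [Filter.Eventually, mem_ae_iff, Set.compl_setOf] at this
    exact this
  have hbad0 : ν.real bad = 0 := by
    rw [measureReal_def, measure_iUnion_null fun j => ?_, ENNReal.toReal_zero]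
    exact Measure.pi_eval_preimage_null (fun _ : Fin k => μ) h0
  -- the covering
  have hcov : T ⊆ bad ∪ (UE ∪ UO ∪ UT) := by
    intro ω hω
    by_cases hb : ∀ j, ω j ⊆ (zdGraph d).edgeSet
    · right
      obtain ⟨L, r, W, hW, hr, hrL, hv, hy, hw, hx, hW0, hW1, hW2, hW3⟩ :=
        exists_trail_of_mem_genDisjOcc_lineEvents₄_eqOne₁₃ hb hω
      rcases mem_sqBoxes_of_trail_eqOne₁₃ c m₂ m₄ M hM hW hr hrL hv hy hw hx hW0 hW1 hW2 hW3 with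
        ⟨LW, hLW, hLWvw, hωE⟩ | ⟨ur, hur, hurvw, hωO⟩ | ⟨uu, huu, huuvw, hωT⟩
      · exact Or.inl (Or.inl (Set.mem_iUnion₂.2 ⟨LW, Finset.mem_filter.2 ⟨hLW, hLWvw⟩, hωE⟩))
      · exact Or.inl (Or.inr (Set.mem_iUnion₂.2 ⟨ur, Finset.mem_filter.2 ⟨hur, hurvw⟩, hωO⟩))
      · exact Or.inr (Set.mem_iUnion₂.2 ⟨uu, Finset.mem_filter.2 ⟨huu, huuvw⟩, hωT⟩)
    · left
      obtain ⟨j, hj⟩ := not_forall.1 hb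
      exact Set.mem_iUnion.2 ⟨j, hj⟩
  -- the measure of each box
  have hE : ν.real UE ≤ ∑ LW ∈ IE, (p : ℝ) ^ LW.1 := by
    refine (measureReal_biUnion_finset_le _ _).trans (Finset.sum_le_sum fun LW hLW => ?_)
    have hi := (Finset.mem_filter.1 hLW).1
    simp only [idxExplicitB, Finset.mem_sigma, Finset.mem_filter, Finset.mem_product, mem_trailWordsTo,
      Finset.mem_Ico, Finset.mem_Icc] at hi
    exact piReal_sqBoxE_le c p hi.2.1.1.1 (by omega) (Nat.le_succ _) (by omega)
  have hO : ν.real UO ≤ ∑ ur ∈ IO, (p : ℝ) ^ M * tau d p (wordPos ur.1 M) x := by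
    refine (measureReal_biUnion_finset_le _ _).trans (Finset.sum_le_sum fun ur hur => ?_)
    have hi := (Finset.mem_filter.1 hur).1
    simp only [idxOneTailB, Finset.mem_filter, Finset.mem_product, mem_trailWords, Finset.mem_Ico] at hi
    exact piReal_sqBoxO_le c p hi.1.1 (by omega) (Nat.le_succ _) (by omega) x
  have hT3 : ν.real UT ≤ ∑ uu ∈ IT, (p : ℝ) ^ (M - (1 + m₄)) * (p : ℝ) ^ (1 + m₄) *
      (tau d p (wordPos uu.1 (M - (1 + m₄))) y * tau d p (y + wordPos uu.2 (1 + m₄)) x) := by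
    refine (measureReal_biUnion_finset_le _ _).trans (Finset.sum_le_sum fun uu huu => ?_)
    have hi := (Finset.mem_filter.1 huu).1
    simp only [idxTwoTail, Finset.mem_product, mem_trailWords] at hi
    have h := piReal_sqBoxT3_le (M := M) (m₃ := 1) (m₄ := m₄) c p hi.1 (hi.2.wordTake (M := 1) (by omega))
      (hi.2.wordSeg (a := 1) (m := m₄) le_rfl) (r₁ := 1) (by omega) x y (y + wordPos uu.2 1)
    have hmid : y + wordPos (wordTake uu.2 1 (by omega : 1 ≤ 1 + m₄)) 1 = y + wordPos uu.2 1 := by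
      rw [wordPos_wordTake uu.2 _ le_rfl]
    have hend : y + wordPos uu.2 1 + wordPos (wordSeg uu.2 1 m₄ (by omega : 1 + m₄ ≤ 1 + m₄)) m₄ =
        y + wordPos uu.2 (1 + m₄) := by
      rw [add_assoc, wordPos_wordSeg uu.2 _ le_rfl]
    rw [hmid, tau_self, mul_one, hend] at h
    calc _ ≤ _ := h
      _ = _ := by rw [pow_add, pow_one]; ring
  calc ν.real T ≤ ν.real (bad ∪ (UE ∪ UO ∪ UT)) := measureReal_mono hcov
    _ ≤ ν.real bad + ν.real (UE ∪ UO ∪ UT) := measureReal_union_le _ _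
    _ ≤ 0 + (ν.real UE + ν.real UO + ν.real UT) := by
        refine add_le_add hbad0.le ((measureReal_union_le _ _).trans ?_)
        exact add_le_add (measureReal_union_le _ _) le_rfl
    _ ≤ _ := by rw [zero_add]; exact add_le_add (add_le_add hE hO) hT3

/-- `ℙ_p^{⊗4}` of the instance's square letters is the product Bernoulli measure, in `ℝ≥0∞`.
[cite: FitznerVanDerHofstad2017, §4.2 (4.17) and the sentence after it (arXiv:1506.07977v2 p. 36)] -/
theorem piPerc_genDisjOcc_lineEvents₄_eq_ofReal (p : unitInterval) (c : Fin 4 → Fin 4) (j₁ j₂ j₃ j₄ : LenIdx)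
    (v y w x : Site d) :
    piPerc d p 4 (genDisjOcc (lineEvents₄ j₁ j₂ j₃ j₄ v y w x) c) =
      ENNReal.ofReal ((Measure.pi (fun _ : Fin 4 => bondPercolation (zdGraph d) p)).real
        (genDisjOcc (lineEvents₄ j₁ j₂ j₃ j₄ v y w x) c)) := by
  rw [piPerc, ofReal_measureReal (measure_ne_top _ _)]

end Pointwise

/-! ## D. The letter `𝓢_{1̲,m₂,1̲,m₄}` of the instance: maximum over the assignments, slots, `∑'` -/

section Letter

variable (p : unitInterval)

/-- **`𝓢_{1̲,m₂,1̲,m₄}(v,y,w,x)` pointwise by extraction** (every member of the maximum obeys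
`piReal_genDisjOcc_lineEvents₄_eqOne₁₃_le`, whose right-hand side does not depend on the assignment).
[cite: FitznerVanDerHofstad2017, §4.2 (4.17) (arXiv:1506.07977v2 p. 36 = EJP p. 33)]
[cite: FitznerVanDerHofstad2016NoBLE, §5.3.2 (5.40)–(5.42) PTRF p. 1098] -/
theorem perc_S_eqOne_ge_eqOne_ge_toReal_le_sum_filter (m₂ m₄ M : ℕ) (hM : m₄ + 2 ≤ M) (x y : Site d)
    (vw : Site d × Site d) :
    ((Letters.perc d p).S (eq 1) (ge m₂) (eq 1) (ge m₄) vw.1 y vw.2 x).toReal ≤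
      (∑ LW ∈ (idxExplicitB (1 + m₂) (1 + m₄) M x y).filter
          (fun LW => (wordPos LW.2.1 1, wordPos LW.2.1 (LW.2.2 + 1)) = vw), (p : ℝ) ^ LW.1) +
        (∑ ur ∈ (idxOneTailB (d := d) (1 + m₂) (1 + m₄) M y).filter
            (fun ur => (wordPos ur.1 1, wordPos ur.1 (ur.2 + 1)) = vw), (p : ℝ) ^ M * tau d p (wordPos ur.1 M) x) +
          ∑ uu ∈ (idxTwoTail (d := d) (1 + m₄) M).filter (fun uu => (wordPos uu.1 1, y + wordPos uu.2 1) = vw),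
            (p : ℝ) ^ (M - (1 + m₄)) * (p : ℝ) ^ (1 + m₄) *
              (tau d p (wordPos uu.1 (M - (1 + m₄))) y * tau d p (y + wordPos uu.2 (1 + m₄)) x) := by
  classical
  have hp0 : 0 ≤ (p : ℝ) := p.2.1
  set B := (∑ LW ∈ (idxExplicitB (1 + m₂) (1 + m₄) M x y).filter
          (fun LW => (wordPos LW.2.1 1, wordPos LW.2.1 (LW.2.2 + 1)) = vw), (p : ℝ) ^ LW.1) +
        (∑ ur ∈ (idxOneTailB (d := d) (1 + m₂) (1 + m₄) M y).filter
            (fun ur => (wordPos ur.1 1, wordPos ur.1 (ur.2 + 1)) = vw), (p : ℝ) ^ M * tau d p (wordPos ur.1 M) x) +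
          ∑ uu ∈ (idxTwoTail (d := d) (1 + m₄) M).filter (fun uu => (wordPos uu.1 1, y + wordPos uu.2 1) = vw),
            (p : ℝ) ^ (M - (1 + m₄)) * (p : ℝ) ^ (1 + m₄) *
              (tau d p (wordPos uu.1 (M - (1 + m₄))) y * tau d p (y + wordPos uu.2 (1 + m₄)) x) with hB
  have hB0 : 0 ≤ B :=
    add_nonneg (add_nonneg (Finset.sum_nonneg fun _ _ => pow_nonneg hp0 _)
      (Finset.sum_nonneg fun _ _ => mul_nonneg (pow_nonneg hp0 _) (tau_nonneg _ _ _)))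
      (Finset.sum_nonneg fun _ _ => mul_nonneg (mul_nonneg (pow_nonneg hp0 _) (pow_nonneg hp0 _))
        (mul_nonneg (tau_nonneg _ _ _) (tau_nonneg _ _ _)))
  have hle : (Letters.perc d p).S (eq 1) (ge m₂) (eq 1) (ge m₄) vw.1 y vw.2 x ≤ ENNReal.ofReal B := by
    rw [perc_S, repLetter]
    refine Finset.sup_le fun c _ => ?_
    rw [piPerc_genDisjOcc_lineEvents₄_eq_ofReal]
    exact ENNReal.ofReal_le_ofReal (piReal_genDisjOcc_lineEvents₄_eqOne₁₃_le c p m₂ m₄ M hM x y vw)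
  have := ENNReal.toReal_mono ENNReal.ofReal_ne_top hle
  rwa [ENNReal.toReal_ofReal hB0] at this

/-- **[NoBLE17] (5.40) shape for `Σ_{v∈S₁} Σ_{w∈S₃} 𝓢_{1̲,m₂,1̲,m₄}(v,y,w,x)`** (line indices `(1+m₂, 1+m₄)`, junction
`y`): the pointwise hypothesis of `sum_le_extraction_of_pointwise` — the sum over the determined pair `(v,w)` is
fiberwise, so the multiplicity stays LINEAR.
[cite: FitznerVanDerHofstad2016NoBLE, §5.3.2 (5.40) PTRF p. 1098]
[cite: FitznerVanDerHofstad2017, §4.2 (4.17), display after (4.18) (arXiv:1506.07977v2 p. 36 = EJP p. 33)] -/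
theorem sum_sum_perc_S_eqOne_ge_eqOne_ge_toReal_le_extraction (m₂ m₄ M : ℕ) (hM : m₄ + 2 ≤ M) (x y : Site d)
    (S₁ S₃ : Finset (Site d)) :
    ∑ v ∈ S₁, ∑ w ∈ S₃, ((Letters.perc d p).S (eq 1) (ge m₂) (eq 1) (ge m₄) v y w x).toReal ≤
      (∑ LW ∈ idxExplicitB (1 + m₂) (1 + m₄) M x y, (p : ℝ) ^ LW.1) +
        (∑ ur ∈ idxOneTailB (d := d) (1 + m₂) (1 + m₄) M y, (p : ℝ) ^ M * tau d p (wordPos ur.1 M) x) +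
          ∑ uu ∈ idxTwoTail (d := d) (1 + m₄) M,
            (p : ℝ) ^ (M - (1 + m₄)) * (p : ℝ) ^ (1 + m₄) *
              (tau d p (wordPos uu.1 (M - (1 + m₄))) y * tau d p (y + wordPos uu.2 (1 + m₄)) x) := by
  classical
  have hp0 : 0 ≤ (p : ℝ) := p.2.1
  rw [← Finset.sum_product' S₁ S₃ fun v w => ((Letters.perc d p).S (eq 1) (ge m₂) (eq 1) (ge m₄) v y w x).toReal]
  refine (Finset.sum_le_sum fun vw _ =>
    perc_S_eqOne_ge_eqOne_ge_toReal_le_sum_filter p m₂ m₄ M hM x y vw).trans ?_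
  rw [Finset.sum_add_distrib, Finset.sum_add_distrib]
  refine add_le_add (add_le_add ?_ ?_) ?_
  · exact Finset.sum_fiberwise_le_sum_of_sum_fiber_nonneg fun _ _ =>
      Finset.sum_nonneg fun _ _ => pow_nonneg hp0 _
  · exact Finset.sum_fiberwise_le_sum_of_sum_fiber_nonneg fun _ _ =>
      Finset.sum_nonneg fun _ _ => mul_nonneg (pow_nonneg hp0 _) (tau_nonneg _ _ _)
  · exact Finset.sum_fiberwise_le_sum_of_sum_fiber_nonneg fun _ _ =>
      Finset.sum_nonneg fun _ _ => mul_nonneg (mul_nonneg (pow_nonneg hp0 _) (pow_nonneg hp0 _))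
        (mul_nonneg (tau_nonneg _ _ _) (tau_nonneg _ _ _))

/-- **EXL-XSLOT (square) at remainder slots, all finite `S₁, S₂, S₃`** (`d ≥ 2`, `p < p_c`, `m₄ + 2 ≤ M`, `x ∈ X`;
`R₁` valid for `[M]`, `R₂` for `[M−(1+m₄), 1+m₄]` on `X`):
`Σ_{y∈S₂} Σ_{v∈S₁} Σ_{w∈S₃} 𝓢_{1̲,m₂,1̲,m₄}(v,y,w,x) ≤ Σ_{L=2+m₂+m₄}^{M−1} (L−1−m₂−m₄) a_L(x) p^L + (M−2−m₂−m₄) p^M Γ̄₂ R₁ + p^M Γ̄₂² R₂`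
— the repulsive BUBBLE bound (5.40) at `(1+m₂, 1+m₄)`: each exact bond costs one unit of length and no multiplicity.
[cite: FitznerVanDerHofstad2016NoBLE, §5.3.2 (5.40) p. 1098, first display p. 1097]
[cite: FitznerVanDerHofstad2017, §4.2 (4.17), (4.18) and the display after it (arXiv:1506.07977v2 p. 36)] -/
theorem sum3_perc_S_eqOne_ge_eqOne_ge_toReal_le_slots (hd : 2 ≤ d) (hp : p < criticalProbI d) {m₂ m₄ M : ℕ}
    (hM : m₄ + 2 ≤ M) {x : Site d} {X : Set (Site d)} (hx : x ∈ X) {R₁ R₂ : ℝ}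
    (hR₁ : IsRemKernelConst d [M] X R₁) (hR₂ : IsRemKernelConst d [M - (1 + m₄), 1 + m₄] X R₂)
    (S₁ S₂ S₃ : Finset (Site d)) :
    ∑ y ∈ S₂, ∑ v ∈ S₁, ∑ w ∈ S₃, ((Letters.perc d p).S (eq 1) (ge m₂) (eq 1) (ge m₄) v y w x).toReal ≤
      (∑ L ∈ Finset.Ico ((1 + m₂) + (1 + m₄)) M,
          ((L + 1 - (1 + m₂) - (1 + m₄) : ℕ) : ℝ) * ((trailWordsTo d L x).card : ℝ) * (p : ℝ) ^ L) +
        ((M - (1 + m₂) - (1 + m₄) : ℕ) : ℝ) * ((p : ℝ) ^ M * (nobleSup2 d p * R₁)) +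
          (p : ℝ) ^ M * (nobleSup2 d p ^ 2 * R₂) :=
  sum_le_repBubble_slots
    (D := fun y => ∑ v ∈ S₁, ∑ w ∈ S₃, ((Letters.perc d p).S (eq 1) (ge m₂) (eq 1) (ge m₄) v y w x).toReal)
    (fun S => sum_le_extraction_of_pointwise p (1 + m₂) (1 + m₄) M x S
      fun y _ => sum_sum_perc_S_eqOne_ge_eqOne_ge_toReal_le_extraction p m₂ m₄ M hM x y S₁ S₃)
    hd hp (by omega) hx hR₁ hR₂ S₂

/-- **EXL-XSLOT (square), `∑'`/`ofReal` shape in the `bubbleSlotR` currency with the out-point on the unit vectors**: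
for `x ∈ X`, `Σ'_y Σ'_w Σ_κ 𝓢_{1̲,m₂,1̲,m₄}(e_κ,y,w,x) ≤ ofReal (bubbleSlotR p Γ̄₂ (1+m₂) (1+m₄) M N R₁ R₂)` whenever `N`
majorises the trail-word counts to `x` and `R₁, R₂` are remainder-kernel constants on `X` (`d ≥ 2`, `p < p_c`,
`m₄ + 2 ≤ M`): every finite partial sum is below the right-hand side (the `2d` unit vectors are distinct sites).
[cite: FitznerVanDerHofstad2016NoBLE, §5.3.2 (5.40) (PTRF 169 (2017) p. 1098)]
[cite: FitznerVanDerHofstad2017, §4.2 (4.17), (4.18) and the display after it (arXiv:1506.07977v2 p. 36); (5.1) p. 49] -/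
theorem tsum_tsum_sum_perc_S_eqOne_ge_eqOne_ge_stepVec_le_ofReal (hd : 2 ≤ d) (hp : p < criticalProbI d)
    {m₂ m₄ M : ℕ} (hM : m₄ + 2 ≤ M) {x : Site d} {X : Set (Site d)} (hx : x ∈ X) {N : ℕ → ℕ}
    (hN : ∀ L, (trailWordsTo d L x).card ≤ N L) {R₁ R₂ : ℝ} (hR₁ : IsRemKernelConst d [M] X R₁)
    (hR₂ : IsRemKernelConst d [M - (1 + m₄), 1 + m₄] X R₂) :
    ∑' y, ∑' w, ∑ κ : Fin d × Bool, (Letters.perc d p).S (eq 1) (ge m₂) (eq 1) (ge m₄) (stepVec κ) y w x ≤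
      ENNReal.ofReal (bubbleSlotR p (nobleSup2 d p) (1 + m₂) (1 + m₄) M N R₁ R₂) := by
  classical
  rw [← ENNReal.tsum_prod, ENNReal.tsum_eq_iSup_sum]
  refine iSup_le fun Q => ?_
  set f : Site d → Site d → Site d → ℝ≥0∞ :=
    fun v y w => (Letters.perc d p).S (eq 1) (ge m₂) (eq 1) (ge m₄) v y w x with hf
  set V : Finset (Site d) := Finset.univ.image (stepVec : Fin d × Bool → Site d) with hV
  have hfin : ∀ v y w, f v y w = ENNReal.ofReal ((f v y w).toReal) := fun v y w =>
    (ENNReal.ofReal_toReal ((perc_S_le_one p _ _ _ _ _ _ _ _).trans_lt ENNReal.one_lt_top).ne).symm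
  have hκ : ∀ y w, ∑ κ : Fin d × Bool, f (stepVec κ) y w = ∑ v ∈ V, f v y w := fun y w => by
    rw [hV, Finset.sum_image fun a _ b _ h => stepVec_injective' h]
  calc ∑ q ∈ Q, ∑ κ : Fin d × Bool, f (stepVec κ) q.1 q.2
      ≤ ∑ q ∈ Q.image Prod.fst ×ˢ Q.image Prod.snd, ∑ κ : Fin d × Bool, f (stepVec κ) q.1 q.2 :=
        Finset.sum_le_sum_of_subset Finset.subset_product
    _ = ∑ y ∈ Q.image Prod.fst, ∑ w ∈ Q.image Prod.snd, ∑ v ∈ V, f v y w := by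
        rw [Finset.sum_product]
        exact Finset.sum_congr rfl fun y _ => Finset.sum_congr rfl fun w _ => hκ y w
    _ = ∑ y ∈ Q.image Prod.fst, ∑ v ∈ V, ∑ w ∈ Q.image Prod.snd, f v y w :=
        Finset.sum_congr rfl fun y _ => Finset.sum_comm
    _ = ∑ y ∈ Q.image Prod.fst, ∑ v ∈ V, ∑ w ∈ Q.image Prod.snd, ENNReal.ofReal ((f v y w).toReal) :=
        Finset.sum_congr rfl fun y _ => Finset.sum_congr rfl fun v _ => Finset.sum_congr rfl fun w _ => hfin v y w
    _ = ENNReal.ofReal (∑ y ∈ Q.image Prod.fst, ∑ v ∈ V, ∑ w ∈ Q.image Prod.snd, (f v y w).toReal) := by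
        rw [ENNReal.ofReal_sum_of_nonneg fun y _ =>
          Finset.sum_nonneg fun v _ => Finset.sum_nonneg fun w _ => ENNReal.toReal_nonneg]
        refine Finset.sum_congr rfl fun y _ => ?_
        rw [ENNReal.ofReal_sum_of_nonneg fun v _ => Finset.sum_nonneg fun w _ => ENNReal.toReal_nonneg]
        exact Finset.sum_congr rfl fun v _ =>
          (ENNReal.ofReal_sum_of_nonneg fun w _ => ENNReal.toReal_nonneg).symm
    _ ≤ ENNReal.ofReal (bubbleSlotR p (nobleSup2 d p) (1 + m₂) (1 + m₄) M N R₁ R₂) :=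
        ENNReal.ofReal_le_ofReal
          ((sum3_perc_S_eqOne_ge_eqOne_ge_toReal_le_slots p hd hp hM hx hR₁ hR₂ _ _ _).trans
            (bubbleSlotR_mono_count p.2.1 (1 + m₂) (1 + m₄) M hN R₁ R₂))

end Letter

/-! ## E. The cells: `(A^ι)_{1,1}` (endpoint a unit vector) and the square part of `(A^ι)_{0,1}` (endpoint `0`) -/

section Cells

variable (p : unitInterval)

/-- **`(A^ι)_{1,1}` by EXL-XSLOT (square)**: `(A^ι)_{1,1} = Σ_{x,y} Σ_κ 𝓢_{1̲,0,1̲,0}(e_κ,x,y,e_{ι₀}) ≤ bubbleSlotR p Γ̄₂ 1 1 M N R₁ R₂`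
at the unit class (`N` majorises the trail-word counts to `e_{ι₀}`, `R₁` valid for `[M]`, `R₂` for `[M−1, 1]` on a
set containing `e_{ι₀}`; `2 ≤ M`) — no peel, no `2d·p` prefactor: both exact bonds are slots of the trail.
[cite: FitznerVanDerHofstad2017, App. B Table B.4 row (1,1) (arXiv:1506.07977v2 p. 74); (5.1) p. 49]
[cite: FitznerVanDerHofstad2016NoBLE, §5.3.2 (5.40) (PTRF 169 (2017) p. 1098)] -/
theorem perc_matAiota_one_one_le_xslot (hd : 2 ≤ d) (hp : p < criticalProbI d) {M : ℕ} (hM : 2 ≤ M)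
    (ι₀ : Fin d × Bool) {X : Set (Site d)} (hι : (stepVec ι₀ : Site d) ∈ X) {N : ℕ → ℕ}
    (hN : ∀ L, (trailWordsTo d L (stepVec ι₀ : Site d)).card ≤ N L) {R₁ R₂ : ℝ}
    (hR₁ : IsRemKernelConst d [M] X R₁) (hR₂ : IsRemKernelConst d [M - 1, 1] X R₂) :
    matAiota (Letters.perc d p) 1 1 ≤ ENNReal.ofReal (bubbleSlotR p (nobleSup2 d p) 1 1 M N R₁ R₂) := by
  rw [perc_matAiota_one_one p ι₀]
  exact tsum_tsum_sum_perc_S_eqOne_ge_eqOne_ge_stepVec_le_ofReal p hd hp (m₂ := 0) (m₄ := 0) hM hι hN hR₁ hR₂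

/-- **The square part of `(A^ι)_{0,1}` by EXL-XSLOT**:
`Σ'_x Σ'_y Σ_κ (1 − δ_{y,0}) 𝓢_{1̲,1,1̲,1}(e_κ,x,y,0) ≤ ofReal (bubbleSlotR p Γ̄₂ 2 2 M N₀ R₁ R₂)` at the endpoint `0` (`N₀`
majorises the closed trail-word counts, `R₁` valid for `[M]`, `R₂` for `[M−2, 2]` on a set containing `0`; `3 ≤ M`);
the other member of `(A^ι)_{0,1}`, `δ_{x,e_κ} 𝓣_{1̲,1̲,2}(e_κ,y,0)`, is the first-leg leaf's.
[cite: FitznerVanDerHofstad2017, App. B Table B.4 row (0,1) (arXiv:1506.07977v2 p. 74); (5.1) p. 49]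
[cite: FitznerVanDerHofstad2016NoBLE, §5.3.2 (5.40) (PTRF 169 (2017) p. 1098)] -/
theorem perc_tsum_tsum_sum_kdc_S_one_one_le_xslot (hd : 2 ≤ d) (hp : p < criticalProbI d) {M : ℕ} (hM : 3 ≤ M)
    {X : Set (Site d)} (h0 : (0 : Site d) ∈ X) {N₀ : ℕ → ℕ}
    (hN : ∀ L, (trailWordsTo d L (0 : Site d)).card ≤ N₀ L) {R₁ R₂ : ℝ} (hR₁ : IsRemKernelConst d [M] X R₁)
    (hR₂ : IsRemKernelConst d [M - 2, 2] X R₂) :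
    ∑' x, ∑' y, ∑ κ : Fin d × Bool, kdc y 0 * (Letters.perc d p).S (.eq 1) (.ge 1) (.eq 1) (.ge 1) (stepVec κ) x y 0 ≤
      ENNReal.ofReal (bubbleSlotR p (nobleSup2 d p) 2 2 M N₀ R₁ R₂) := by
  refine le_trans (ENNReal.tsum_le_tsum fun x => ENNReal.tsum_le_tsum fun y => Finset.sum_le_sum fun κ _ => ?_)
    (tsum_tsum_sum_perc_S_eqOne_ge_eqOne_ge_stepVec_le_ofReal p hd hp (m₂ := 1) (m₄ := 1) hM h0 hN hR₁ hR₂)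
  calc kdc y 0 * (Letters.perc d p).S (.eq 1) (.ge 1) (.eq 1) (.ge 1) (stepVec κ) x y 0
      ≤ 1 * (Letters.perc d p).S (.eq 1) (.ge 1) (.eq 1) (.ge 1) (stepVec κ) x y 0 := by
        gcongr; exact kdc_le_one y 0
    _ = _ := one_mul _

end Cells

end Literature.Probability.FitznerVanDerHofstad2017.NobleBlocks
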